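import Summits.NavierStokesRegularity.NavierStokesRegularity.Theses.AxisymmetricExtremality
import Literature.Analysis.FluidPDE.KatoMaximalTime
import Literature.Analysis.FluidPDE.KatoFarFieldBound
import Literature.Analysis.FluidPDE.NSSereginL3BlowupHolds
import Literature.Analysis.FluidPDE.KatoL3Uniqueness
import Literature.Analysis.FluidPDE.KatoLocalHolds
import Literature.Analysis.FluidPDE.KNSSLiouville
import Literature.Analysis.FluidPDE.AxisymmetricEuler
import HarnessLib

/-!
# Strategist census s20-g5 — typed census objects for the crux `AxisymmetricKatoGlobal`
(stmt-NavierStokesRegularity-15453, route AxisymmetricExtremality)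

Scratch file of the SECOND INDEPENDENT strategy census (family `s`, gen 5).  Nothing here is a
route item or a registered line.  It types, over existing declarations only:

* `RotInv` — the crux's unfolded axisymmetry clause (= `IsAxisymmetric`, `Iff.rfl`);
* **W1** `NoAxisymMinimalBlowupDatum` — the weakest statement the route's `closes` actually
  consumes (threshold instance of the crux), with `AxisymmetricKatoGlobal → W1` and
  `closes`-with-W1 (pure logic, copied from the route file);
* **D3** `AxisymCritNormLiminf` — "axisymmetric Kato solutions do not blow up in `L³`", with the
  seam `D3 → crux` PROVED from tree theorems (Kato maximal time, Lemarié-Rieusset's singular point,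
  Seregin 2012 / L-R Thm 15.5 core form) and the converse `crux → D3` PROVED (Kato uniqueness +
  `C_t L³` continuity): D3 is an EQUIVALENT REFORMULATION, recorded as such;
* **D4** `LocalAbsEpsSwirlAtAxis`, `SwirlStarvationAtAxis`, `OffAxisFinalTimeBounded` — the best
  genuinely two-piece split found (absolute small-swirl ε-regularity at axis points ∧ swirl
  starvation at the singular axis point), with the seam PROVED modulo the off-axis bookkeeping
  hypothesis (landed in the tree in the registered line's vocabulary, stubs 2b' + K);
* **S1** `AxisymBoundedAncientLiouvilleSwirl` — the KNSS Liouville conjecture in the axisymmetric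
  class WITH swirl (strengthening attempt; typed only — it does not imply the crux, Type II gap).
-/

set_option linter.dupNamespace false

noncomputable section

open MeasureTheory Set Function Filter Topology Metric
open scoped ENNReal NNReal

namespace Summit.NavierStokesRegularity.NavierStokesRegularity.Cruxes.AxisymmetricKatoGlobal.StrategistS20g5

open Literature.Analysis.FluidPDE
open Summit.NavierStokesRegularity.NavierStokesRegularity.Theses.AxisymmetricExtremality
  (MinimalDatumPFold PFoldToAxisymmetric AxisymmetricKatoGlobal)

/-- The unfolded axisymmetry clause of the crux, verbatim. -/
def RotInv (u₀ : EuclideanSpace ℝ (Fin 3) → EuclideanSpace ℝ (Fin 3)) : Prop :=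
  ∀ (θ : ℝ) (x : EuclideanSpace ℝ (Fin 3)), u₀ (WithLp.toLp 2 ![Real.cos θ * x 0 - Real.sin θ * x 1, Real.sin θ * x 0 + Real.cos θ * x 1, x 2]) = WithLp.toLp 2 ![Real.cos θ * u₀ x 0 - Real.sin θ * u₀ x 1, Real.sin θ * u₀ x 0 + Real.cos θ * u₀ x 1, u₀ x 2]

/-- `RotInv` is `IsAxisymmetric` unfolded (definitional). -/
theorem rotInv_iff_isAxisymmetric (u₀ : EuclideanSpace ℝ (Fin 3) → EuclideanSpace ℝ (Fin 3)) :
    RotInv u₀ ↔ IsAxisymmetric u₀ := Iff.rfl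

/-- Sanity: the crux is literally "`RotInv` data have global Kato solutions". -/
theorem crux_iff : AxisymmetricKatoGlobal ↔
    ∀ ν : ℝ, 0 < ν → ∀ (u₀ : EuclideanSpace ℝ (Fin 3) → EuclideanSpace ℝ (Fin 3))
      (g : Literature.Analysis.FunctionSpaces.HomSobolev (EuclideanSpace ℝ (Fin 3)) (EuclideanSpace ℂ (Fin 3)) (1 / 2 : ℝ)),
      MemLp u₀ 3 volume → g.Represents (Literature.Analysis.FunctionSpaces.EuclideanSpace.complexify ∘ u₀) →
      IsWeaklyDivFree u₀ → RotInv u₀ → HasGlobalKatoSolution ν u₀ := Iff.rfl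

/-! ## W1 — the weakest intermediate consumed by `closes`: no axisymmetric minimal blow-up datum -/

/-- **W1 (NAMB).** No Rusin–Šverák minimal blow-up datum is axisymmetric.  This is the threshold
instance of the crux and is ALL that the route's deciding theorem uses. -/
def NoAxisymMinimalBlowupDatum : Prop :=
  ∀ ν : ℝ, 0 < ν → ∀ (u₀ : EuclideanSpace ℝ (Fin 3) → EuclideanSpace ℝ (Fin 3))
    (g : Literature.Analysis.FunctionSpaces.HomSobolev (EuclideanSpace ℝ (Fin 3)) (EuclideanSpace ℂ (Fin 3)) (1 / 2 : ℝ)),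
    IsMinimalBlowupDatum ν u₀ g → RotInv u₀ → False

/-- crux ⇒ W1 (trivial). -/
theorem noAxisymMinimalBlowupDatum_of_crux (h : AxisymmetricKatoGlobal) : NoAxisymMinimalBlowupDatum := by
  intro ν hν u₀ g hmin hax
  obtain ⟨hL3, hrep, hdiv, -, hnot⟩ := hmin
  exact hnot (h ν hν u₀ g hL3 hrep hdiv hax)

/-- W1 suffices for the route: the deciding theorem with W1 in place of the crux (same pure-logic
proof as the route file's `closes`). -/
theorem closes_of_noAxisymMinimalBlowupDatum (h₂ : MinimalDatumPFold) (h₄ : PFoldToAxisymmetric)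
    (h₃ : NoAxisymMinimalBlowupDatum) : _root_.NavierStokesRegularity := by
  show Literature.NS.NavierStokesExistenceSmoothR3
  intro ν hν u₀ hsm hdiv hdec
  by_contra hno
  obtain ⟨u₁, g, hmin, hax⟩ := h₄ ν hν (h₂ ν hν ⟨u₀, hsm, hdiv, hdec, hno⟩)
  exact h₃ ν hν u₁ g hmin hax

/-! ## D3 — equivalent reformulation: the critical `L³` norm does not blow up -/

/-- **D3.** Along every Kato solution on `[0, T)` from an axisymmetric crux-datum,
`liminf_{t ↑ T} ‖u(t)‖_{L³} < ∞`. -/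
def AxisymCritNormLiminf : Prop :=
  ∀ ν : ℝ, 0 < ν → ∀ (u₀ : EuclideanSpace ℝ (Fin 3) → EuclideanSpace ℝ (Fin 3))
    (g : Literature.Analysis.FunctionSpaces.HomSobolev (EuclideanSpace ℝ (Fin 3)) (EuclideanSpace ℂ (Fin 3)) (1 / 2 : ℝ)),
    MemLp u₀ 3 volume → g.Represents (Literature.Analysis.FunctionSpaces.EuclideanSpace.complexify ∘ u₀) →
    IsWeaklyDivFree u₀ → RotInv u₀ →
    ∀ T : ℝ, 0 < T → ∀ u : ℝ → EuclideanSpace ℝ (Fin 3) → EuclideanSpace ℝ (Fin 3),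
      IsKatoSolutionOn T ν u₀ u → ∃ M : ℝ≥0, ∃ᶠ t in 𝓝[<] T, eLpNorm (u t) 3 volume ≤ M

/-- **Seam D3 ⇒ crux, PROVED** (tree theorems only: `kato_local_holds`, `kato_unique_holds`,
`exists_isKatoSolutionOn_katoMaximalTime`, `lemarieRieusset_singular_point_of_blowup_holds`,
`seregin_regular_of_liminf_L3_holds`). -/
theorem crux_of_axisymCritNormLiminf (h : AxisymCritNormLiminf) : AxisymmetricKatoGlobal := by
  intro ν hν u₀ g hL3 hrep hdiv hax
  by_cases htop : katoMaximalTime ν u₀ = ⊤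
  · exact hasGlobalKatoSolution_of_katoMaximalTime_eq_top kato_unique_holds hν htop
  exfalso
  have hTm0 : 0 < katoMaximalTime ν u₀ := katoMaximalTime_pos kato_local_holds hν hL3 hdiv
  have htop' : katoMaximalTime ν u₀ < ⊤ := lt_top_iff_ne_top.2 htop
  obtain ⟨w, hw⟩ := exists_isKatoSolutionOn_katoMaximalTime kato_unique_holds hν hTm0 htop'
  set T : ℝ := (katoMaximalTime ν u₀).toReal with hT_def
  have hT0 : 0 < T := ENNReal.toReal_pos hTm0.ne' htop'.ne
  have hofReal : ENNReal.ofReal T = katoMaximalTime ν u₀ := ENNReal.ofReal_toReal htop'.ne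
  have hmax : ∀ T'' : ℝ, T < T'' →
      ∀ w' : ℝ → EuclideanSpace ℝ (Fin 3) → EuclideanSpace ℝ (Fin 3), ¬ IsKatoSolutionOn T'' ν u₀ w' :=
    fun T'' hT'' w' => not_isKatoSolutionOn_of_katoMaximalTime_lt (by
      rw [← hofReal]
      exact (ENNReal.ofReal_lt_ofReal_iff (hT0.trans hT'')).2 hT'')
  obtain ⟨x₁, hx₁⟩ := lemarieRieusset_singular_point_of_blowup_holds hν hT0 hL3 hdiv hw hmax
  obtain ⟨r, hr0, hbd⟩ :=
    seregin_regular_of_liminf_L3_holds hν hT0 hL3 hdiv hw (h ν hν u₀ g hL3 hrep hdiv hax T hT0 w hw) x₁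
  exact hbd.ne (eLpNorm_top_parabolicCylinder_eq_top_of_small hT0 hx₁ hr0)

/-- **Converse crux ⇒ D3, PROVED** (Kato uniqueness + continuity in `L³` of the global solution at
`T`): D3 is an equivalent reformulation of the crux over the tree, not a weaker piece. -/
theorem axisymCritNormLiminf_of_crux (h : AxisymmetricKatoGlobal) : AxisymCritNormLiminf := by
  intro ν hν u₀ g hL3 hrep hdiv hax T hT u hu
  obtain ⟨v, hv⟩ := (h ν hν u₀ g hL3 hrep hdiv hax).exists_isKatoSolutionOn (T + 1)
  have hTmem : T ∈ Ico 0 (T + 1) := ⟨hT.le, by linarith⟩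
  have hvT : MemLp (v T) 3 volume := hv.memLp hTmem
  -- continuity of `v` in `L³` at `T` within `[0, T+1)`
  have hc : Tendsto (fun t => eLpNorm (v t - v T) 3 volume) (𝓝[Ico 0 (T + 1)] T) (𝓝 0) :=
    hv.continuousInLpOn.2 T hTmem
  have hev : ∀ᶠ t in 𝓝[Ico 0 (T + 1)] T, eLpNorm (v t - v T) 3 volume < 1 :=
    hc.eventually (gt_mem_nhds zero_lt_one)
  -- pass to the left filter at `T`
  have hle : 𝓝[<] T ≤ 𝓝[Ico 0 (T + 1)] T := by
    rw [← nhdsWithin_Ioo_eq_nhdsLT hT]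
    exact nhdsWithin_mono _ fun t ht => ⟨ht.1.le, by linarith [ht.2]⟩
  have hev' : ∀ᶠ t in 𝓝[<] T, eLpNorm (v t - v T) 3 volume < 1 := hle hev
  have hIoo : ∀ᶠ t in 𝓝[<] T, t ∈ Ioo 0 T := by
    rw [← nhdsWithin_Ioo_eq_nhdsLT hT]; exact self_mem_nhdsWithin
  refine ⟨(eLpNorm (v T) 3 volume + 1).toNNReal, ((hev'.and hIoo).mono fun t ht => ?_).frequently⟩
  obtain ⟨hlt, ht0, htT⟩ := ht
  have hae : u t =ᵐ[volume] v t := hu.ae_eq kato_unique_holds hν hv ht0.le htT (by linarith)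
  rw [eLpNorm_congr_ae hae]
  have hvt : MemLp (v t) 3 volume := hv.memLp ⟨ht0.le, by linarith⟩
  have htri : eLpNorm (v t) 3 volume ≤ eLpNorm (v t - v T) 3 volume + eLpNorm (v T) 3 volume := by
    have := eLpNorm_add_le (hvt.aestronglyMeasurable.sub hvT.aestronglyMeasurable) hvT.aestronglyMeasurable
      (by norm_num : (1 : ℝ≥0∞) ≤ 3)
    simpa only [sub_add_cancel] using this
  have hfin : eLpNorm (v T) 3 volume + 1 ≠ ⊤ := ENNReal.add_ne_top.2 ⟨hvT.eLpNorm_ne_top, ENNReal.one_ne_top⟩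
  rw [ENNReal.coe_toNNReal hfin]
  calc eLpNorm (v t) 3 volume ≤ eLpNorm (v t - v T) 3 volume + eLpNorm (v T) 3 volume := htri
    _ ≤ 1 + eLpNorm (v T) 3 volume := by gcongr
    _ = eLpNorm (v T) 3 volume + 1 := add_comm _ _

/-! ## D4 — the best genuinely two-piece split: absolute ε-regularity of small swirl at the axis
## ∧ swirl starvation at the singular axis point -/

/-- Axis points: `x₀ = x₁ = 0`. -/
def OnAxis (x : EuclideanSpace ℝ (Fin 3)) : Prop := x 0 = 0 ∧ x 1 = 0

/-- **D4-ε (open rung above Lei–Zhang / Wei / Seregin 2022).** There is an ABSOLUTE `ε > 0` such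
that an axisymmetric Kato solution (viscosity `ν`) whose swirl `Γ = x₀u₁ − x₁u₀` satisfies
`|Γ| ≤ ε ν` on a backward parabolic neighbourhood `(T − r², T) × B(x₀, r)` of an axis point
`(T, x₀)` is essentially bounded near `(T, x₀)`.  (Printed criteria need a MODULUS `|Γ| ≤ C/|ln r|^α`
— Lei–Zhang 2017 Cor 1.3 (α = 2), Wei 2016 (α = 3/2), Seregin 2022 §2 (α = 3, local) — or RELATIVE
smallness `‖Γ₀‖_∞ ≤ δ/M₀` (Lei–Zhang 2017 Thm 1.4 = `LeiZhang2017_smallSwirl_regularity`).) -/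
def LocalAbsEpsSwirlAtAxis : Prop :=
  ∃ ε : ℝ, 0 < ε ∧ ∀ ν : ℝ, 0 < ν → ∀ (u₀ : EuclideanSpace ℝ (Fin 3) → EuclideanSpace ℝ (Fin 3)),
    MemLp u₀ 3 volume → IsWeaklyDivFree u₀ → RotInv u₀ →
    ∀ T : ℝ, 0 < T → ∀ u : ℝ → EuclideanSpace ℝ (Fin 3) → EuclideanSpace ℝ (Fin 3), IsKatoSolutionOn T ν u₀ u →
    ∀ x₀ : EuclideanSpace ℝ (Fin 3), OnAxis x₀ → ∀ r : ℝ, 0 < r → r ^ 2 < T →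
      (∀ t ∈ Ioo (T - r ^ 2) T, ∀ x ∈ ball x₀ r, |swirl (u t) x| ≤ ε * ν) →
      ∃ ρ : ℝ, 0 < ρ ∧ eLpNorm (uncurry u) ∞ (volume.restrict (parabolicCylinder ρ ((T : ℝ), x₀))) < ∞

/-- **D4-starvation (open, no mechanism known).** Along a Kato solution on `[0, T)` from an
axisymmetric crux-datum with `T` MAXIMAL, the swirl becomes uniformly small near every axis point at
the final time: `∀ δ > 0 ∃ r > 0, |Γ| ≤ δ` on `(T − r², T) × B(x₀, r)`.  (At regular final times this
is continuity of `Γ`, which vanishes on the axis; at a blow-up time it is an a-priori modulus of `Γ`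
WITHOUT RATE — strictly weaker than the registered stub `stub_swirlAxisModulus` (rate `1/ln³`), and
still the whole difficulty.) -/
def SwirlStarvationAtAxis : Prop :=
  ∀ ν : ℝ, 0 < ν → ∀ (u₀ : EuclideanSpace ℝ (Fin 3) → EuclideanSpace ℝ (Fin 3))
    (g : Literature.Analysis.FunctionSpaces.HomSobolev (EuclideanSpace ℝ (Fin 3)) (EuclideanSpace ℂ (Fin 3)) (1 / 2 : ℝ)),
    MemLp u₀ 3 volume → g.Represents (Literature.Analysis.FunctionSpaces.EuclideanSpace.complexify ∘ u₀) →
    IsWeaklyDivFree u₀ → RotInv u₀ →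
    ∀ T : ℝ, 0 < T → ∀ u : ℝ → EuclideanSpace ℝ (Fin 3) → EuclideanSpace ℝ (Fin 3), IsKatoSolutionOn T ν u₀ u →
    (∀ T' : ℝ, T < T' → ∀ v : ℝ → EuclideanSpace ℝ (Fin 3) → EuclideanSpace ℝ (Fin 3), ¬ IsKatoSolutionOn T' ν u₀ v) →
    ∀ x₀ : EuclideanSpace ℝ (Fin 3), OnAxis x₀ → ∀ δ : ℝ, 0 < δ →
      ∃ r : ℝ, 0 < r ∧ r ^ 2 < T ∧ ∀ t ∈ Ioo (T - r ^ 2) T, ∀ x ∈ ball x₀ r, |swirl (u t) x| ≤ δ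

/-- **D4-off (bookkeeping; in the tree as the registered line's stubs 2b' + K, there phrased with
an axisymmetric pressure and local energy classes).** Off the axis an axisymmetric Kato solution is
bounded near the final time (rotation packing + ε-regularity, Caffarelli–Kohn–Nirenberg). Typed
here only to close the seam; not claimed proved in this form. -/
def OffAxisFinalTimeBounded : Prop :=
  ∀ ν : ℝ, 0 < ν → ∀ (u₀ : EuclideanSpace ℝ (Fin 3) → EuclideanSpace ℝ (Fin 3)),
    MemLp u₀ 3 volume → IsWeaklyDivFree u₀ → RotInv u₀ →
    ∀ T : ℝ, 0 < T → ∀ u : ℝ → EuclideanSpace ℝ (Fin 3) → EuclideanSpace ℝ (Fin 3), IsKatoSolutionOn T ν u₀ u →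
    ∀ x₀ : EuclideanSpace ℝ (Fin 3), ¬ OnAxis x₀ →
      ∃ ρ : ℝ, 0 < ρ ∧ eLpNorm (uncurry u) ∞ (volume.restrict (parabolicCylinder ρ ((T : ℝ), x₀))) < ∞

/-- **Seam D4 ⇒ crux, PROVED modulo the three hypotheses** (two open pieces + the off-axis
bookkeeping): maximal Kato solution, Lemarié-Rieusset singular point `x₁`; off the axis `D4-off`
contradicts it; on the axis starvation makes `|Γ| ≤ ε ν` near `(T, x₁)` and `D4-ε` bounds `u`
there — contradiction. -/
theorem crux_of_absEps_of_starvation (hε : LocalAbsEpsSwirlAtAxis) (hst : SwirlStarvationAtAxis)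
    (hoff : OffAxisFinalTimeBounded) : AxisymmetricKatoGlobal := by
  intro ν hν u₀ g hL3 hrep hdiv hax
  by_cases htop : katoMaximalTime ν u₀ = ⊤
  · exact hasGlobalKatoSolution_of_katoMaximalTime_eq_top kato_unique_holds hν htop
  exfalso
  have hTm0 : 0 < katoMaximalTime ν u₀ := katoMaximalTime_pos kato_local_holds hν hL3 hdiv
  have htop' : katoMaximalTime ν u₀ < ⊤ := lt_top_iff_ne_top.2 htop
  obtain ⟨w, hw⟩ := exists_isKatoSolutionOn_katoMaximalTime kato_unique_holds hν hTm0 htop'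
  set T : ℝ := (katoMaximalTime ν u₀).toReal with hT_def
  have hT0 : 0 < T := ENNReal.toReal_pos hTm0.ne' htop'.ne
  have hofReal : ENNReal.ofReal T = katoMaximalTime ν u₀ := ENNReal.ofReal_toReal htop'.ne
  have hmax : ∀ T'' : ℝ, T < T'' →
      ∀ w' : ℝ → EuclideanSpace ℝ (Fin 3) → EuclideanSpace ℝ (Fin 3), ¬ IsKatoSolutionOn T'' ν u₀ w' :=
    fun T'' hT'' w' => not_isKatoSolutionOn_of_katoMaximalTime_lt (by
      rw [← hofReal]
      exact (ENNReal.ofReal_lt_ofReal_iff (hT0.trans hT'')).2 hT'')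
  obtain ⟨x₁, hx₁⟩ := lemarieRieusset_singular_point_of_blowup_holds hν hT0 hL3 hdiv hw hmax
  by_cases hon : OnAxis x₁
  · obtain ⟨ε, hε0, hεreg⟩ := hε
    obtain ⟨r, hr0, hrT, hsmall⟩ := hst ν hν u₀ g hL3 hrep hdiv hax T hT0 w hw hmax x₁ hon (ε * ν) (by positivity)
    obtain ⟨ρ, hρ0, hbd⟩ := hεreg ν hν u₀ hL3 hdiv hax T hT0 w hw x₁ hon r hr0 hrT hsmall
    exact hbd.ne (eLpNorm_top_parabolicCylinder_eq_top_of_small hT0 hx₁ hρ0)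
  · obtain ⟨ρ, hρ0, hbd⟩ := hoff ν hν u₀ hL3 hdiv hax T hT0 w hw x₁ hon
    exact hbd.ne (eLpNorm_top_parabolicCylinder_eq_top_of_small hT0 hx₁ hρ0)

/-! ## S1 — strengthening attempt: KNSS's Liouville conjecture in the axisymmetric class with swirl -/

/-- **S1.** Bounded ancient weak solutions (`ν = 1`) on `ℝ³ × (−∞, 0)` which are axisymmetric (as
`L^∞` functions) are spatially constant — the axisymmetric case WITH swirl of the KNSS Liouville
conjecture (arXiv:0709.3599 p. 3; "the case without the no-swirl assumption is open", p. 10); typed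
as `KNSS2009_liouville_axisymmetric_no_swirl` minus its third hypothesis.  It excludes only Type I
blow-up (already a theorem: `knss_no_axisymmetric_typeI_holds`, Seregin 2020 Thm 2.1 discharged),
so it does NOT imply the crux. -/
def AxisymBoundedAncientLiouvilleSwirl : Prop :=
  ∀ ⦃u : ℝ → EuclideanSpace ℝ (Fin 3) → EuclideanSpace ℝ (Fin 3)⦄,
    IsBoundedWeakNSSolutionOn (Iio 0) isOpen_Iio 1 u →
    (∀ θ : ℝ, ∀ᵐ t ∂(volume.restrict (Iio (0 : ℝ))),
      (fun x => u t (rotZ θ x)) =ᵐ[volume] fun x => rotZ θ (u t x)) →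
    ∃ b : ℝ → ℝ, Measurable b ∧ (∃ C : ℝ, ∀ t, |b t| ≤ C) ∧
      ∀ᵐ t ∂(volume.restrict (Iio (0 : ℝ))), u t =ᵐ[volume] fun _ => b t • eZ

/-- S1 contains the printed no-swirl theorem (KNSS Thm 5.2) as the special case with the swirl
hypothesis added back. -/
theorem knss_noSwirl_of_S1 (h : AxisymBoundedAncientLiouvilleSwirl) : KNSS2009_liouville_axisymmetric_no_swirl :=
  fun u hu hax _ => h hu hax

end Summit.NavierStokesRegularity.NavierStokesRegularity.Cruxes.AxisymmetricKatoGlobal.StrategistS20g5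

end
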